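import Summits.ResolutionOfSingularities.ResolutionOfSingularities.Theorems.EquisingularLiftEquisingularLiftNatDirectionSections
import Summits.ResolutionOfSingularities.ResolutionOfSingularities.Theorems.EquisingularLiftEquisingularLiftNatProportionalCocycle
import Summits.ResolutionOfSingularities.ResolutionOfSingularities.Theorems.EquisingularLiftEquisingularLiftNatDirectionConormalFrameChart
import Summits.ResolutionOfSingularities.ResolutionOfSingularities.Theorems.EquisingularLiftEquisingularLiftNatConormalSectionTransition
import Summits.ResolutionOfSingularities.ResolutionOfSingularities.Theorems.EquisingularLiftEquisingularLiftNatCocycleSquareOfLocal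
import Summits.ResolutionOfSingularities.ResolutionOfSingularities.Theorems.EquisingularLiftEquisingularLiftNatDirDictCriterion
import Summits.ResolutionOfSingularities.ResolutionOfSingularities.Theorems.EquisingularLiftEquisingularLiftNatFrameOfUnitDet
import Summits.ResolutionOfSingularities.ResolutionOfSingularities.Theorems.EquisingularLiftEquisingularLiftNatAdaptedFrameRelUniq
import Summits.ResolutionOfSingularities.ResolutionOfSingularities.Theorems.EquisingularLiftEquisingularLiftNatTransitionDictFrame
import Summits.ResolutionOfSingularities.ResolutionOfSingularities.Theorems.EquisingularLiftEquisingularLiftNatAdaptedFrameRelOfDict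
import Summits.ResolutionOfSingularities.ResolutionOfSingularities.Theorems.EquisingularLiftEquisingularLiftNatDictAdaptedFrame
import Literature.AlgebraicGeometry.Modules.UnitCocyclePullback
import Literature.AlgebraicGeometry.Modules.LineBundleOfCocycleClass
import Mathlib.LinearAlgebra.Matrix.NonsingularInverse
import HarnessLib

/-!
# [OURS · L1 W4.5(b) · EL♮(3) (L) brick C2, keystone (★)] The class of the conormal bundle of the section of the exceptional `ℙ¹`-bundle

Cell res-hironaka, LADDER-RESOLUTION rung L, slot W4.5(b), crux chain w45b: EL♮(3) = stmt-ResolutionOfSingularities-20148, brick C2 of the (L) socket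
`stub_elnat_three_liftSections` (census `Cruxes/EquisingularLiftNatThree/Lines/C2-CENSUS-res-type-027.md`, desk ruling 2026-08-27T23:27:38Z «C2 AS TYPED»;
sig `L/res-type-027/Bstar-ConormalSectionClass.sig.lean`). Seat res-type-027 g15 (C2 architect). `--supports stmt-ResolutionOfSingularities-20148 --as helper`.
OURS; NOT a statement of any manuscript; AI-written, weaker than expert review. Definition-free; standard axioms.
`cechPic_pullback_detClass_conormal_section`: with C1c's data (`exists_directionSections`: `U`, `w`, `ρ`, proportionality, DICT), the round `υ₁` (blow-up
along `Ī`), the reduced exceptional divisor `Ẽ₁`, the section `Γ̃₁ = V(σᶜ(𝒟',1))`, `i₁ : Γ̃₁ ⟶ Ẽ₁` and `Φ : Y' ≅ Γ̃₁` over `ψ`: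
`HasRank (conormalSheaf i₁) 1` and `Φ^*[det 𝒞_{Γ̃₁/Ẽ₁}]·[det F] = [L₀]²` in `CechPic Y'` (`F = g^*ε^*𝒞_{V(I)}`, `L₀ = lineBundle (proportionalCocycle …)`)
— the Euler identification `𝒩_{Γ̃₁/Ẽ₁} ≅ 𝓗om(L₀, F/L₀)` in cocycle-class currency. PROOF: per point X1's DICT-adapted frame `c^p = A^p·x^p|` (p591546),
the chart `G₁[W'_p,c^p₁]` and ratio `T_p` (B1a p587502), B1b's conormal frame `κ_p` (p588874), the adapted frame `f^p = ψ'♯(A^p)·g^*ε^*e_{V_p}` of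
`F` (X4 p589817, `f^p₀ = w p|`); locally on affine pieces: `c^q = M'·c^p` (Σ3 p590736), `M'₀₁ ∈ Ī` (X2-uniq p590138), the B1c chain (p588934)
`T(κ_p,κ_q)·M̄'₁₁ = M̄'₀₀` pulled back along `Φ` (`Φ ≫ i₁ ≫ ι_E ≫ υ₁ = ψ'`), `T(f^p,f^q) = ψ'♯M'` (Σ2 p590578); Σ1 (p589696) concludes.
[cite: Hartshorne1977, II Thm. 8.24 (b), II Ex. 5.16, III Ex. 4.5] [folklore: relative Euler sequence on a section of a projective bundle, in frames]
-/

set_option linter.dupNamespace false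

noncomputable section

open CategoryTheory CategoryTheory.Limits AlgebraicGeometry Opposite TopologicalSpace
open Literature.AlgebraicGeometry.Modules Literature.AlgebraicGeometry.Morphisms
open Literature.AlgebraicGeometry.Deformation Literature.AlgebraicGeometry.Motives
open Literature.AlgebraicGeometry.HodgeTheory Literature.AlgebraicGeometry.Resolution
open AlgebraicGeometry.Scheme.IdealSheafData
open Summit.ResolutionOfSingularities.ResolutionOfSingularities.Cruxes.EquisingularLiftNat.P1VB

namespace Summit.ResolutionOfSingularities.ResolutionOfSingularities.Cruxes.EquisingularLiftNat.Sections

/-! ## The keystone -/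

/-- **(★) — the class of the conormal bundle of the section of the exceptional `ℙ¹`-bundle, in C1c's currency**: `HasRank (conormalSheaf i₁) 1` and
`Φ^*[det 𝒞_{Γ̃₁/Ẽ₁}] · [det F] = [L₀]²` in `CechPic Y'` (see the module docstring). -/
theorem cechPic_pullback_detClass_conormal_section
    {X₀ G₀ Y Y' : Scheme.{0}} (j₀ : G₀ ⟶ X₀) [IsLocallyNoetherian X₀] [IsLocallyNoetherian G₀]
    (I : X₀.IdealSheafData) (_hri : IsRegularImmersionOfCodim I.subschemeι 2)
    (ε : Y ⟶ I.subscheme) (g : Y' ⟶ Y)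
    (Ī : G₀.IdealSheafData) (hĪ : I.comap j₀ = Ī)
    (ψ : Y' ⟶ Ī.subscheme) (hψ : ψ ≫ Ī.subschemeι ≫ j₀ = g ≫ ε ≫ I.subschemeι)
    (𝒟' : G₀.IdealSheafData)
    (hdir' : ∀ z ∈ Ī.support, ∃ c : Fin 2 → G₀.presheaf.stalk z,
      Ideal.span (Set.range c) = stalkIdeal Ī z ∧ IsQuasiRegular c ∧
      stalkIdeal 𝒟' z = Ideal.span {c 0} ⊔ Ideal.span {c 1 * c 1})
    (U : Y' → Y'.Opens) (hU : ∀ p, p ∈ U p)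
    (w : ∀ p, Γ((Scheme.Modules.pullback g).obj ((Scheme.Modules.pullback ε).obj (conormalSheaf I.subschemeι)), U p))
    (ρ : ∀ p, ((Scheme.Modules.pullback g).obj ((Scheme.Modules.pullback ε).obj (conormalSheaf I.subschemeι))).over (U p) ⟶
      (unitModule Y').over (U p))
    (hρ : ∀ p, @Eq Γ(Y', U p) (appLE (ρ p) (𝟙 (U p)) (w p)) 1)
    (hprop : ∀ (p p' : Y') (V : Y'.Opens) (hp : V ≤ U p) (hp' : V ≤ U p'), ∃ u : Γ(Y', V),
      ((Scheme.Modules.pullback g).obj ((Scheme.Modules.pullback ε).obj (conormalSheaf I.subschemeι))).presheaf.map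
          (homOfLE hp').op (w p') =
        u • ((Scheme.Modules.pullback g).obj ((Scheme.Modules.pullback ε).obj (conormalSheaf I.subschemeι))).presheaf.map
          (homOfLE hp).op (w p))
    (hDICT : ∀ p, ∃ (V : X₀.affineOpens) (x : Fin 2 → Γ(X₀, (V : X₀.Opens))) (s : Fin 2 → Γ(idealModule I.subschemeι, (V : X₀.Opens)))
      (_ : RingTheory.Sequence.IsWeaklyRegular Γ(X₀, (V : X₀.Opens)) (List.ofFn x))
      (_ : Ideal.span (Set.range x) = I.ideal V)
      (_ : ∀ j, toRing (idealModuleι I.subschemeι) (V : X₀.Opens) (s j) = x j)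
      (hUV : U p ≤ g ⁻¹ᵁ (ε ⁻¹ᵁ (I.subschemeι ⁻¹ᵁ (V : X₀.Opens))))
      (W : G₀.affineOpens) (hWV : (W : G₀.Opens) ≤ j₀ ⁻¹ᵁ (V : X₀.Opens))
      (hUW : U p ≤ (ψ ≫ Ī.subschemeι) ⁻¹ᵁ (W : G₀.Opens))
      (α : Fin 2 → Γ(G₀, (W : G₀.Opens))),
      w p = ∑ j, (ψ ≫ Ī.subschemeι).appLE (W : G₀.Opens) (U p) hUW (α j) •
        ((Scheme.Modules.pullback g).obj ((Scheme.Modules.pullback ε).obj (conormalSheaf I.subschemeι))).presheaf.map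
          (homOfLE hUV).op
          (unitSection g ((Scheme.Modules.pullback ε).obj (conormalSheaf I.subschemeι)) (ε ⁻¹ᵁ (I.subschemeι ⁻¹ᵁ (V : X₀.Opens)))
            (unitSection ε (conormalSheaf I.subschemeι) (I.subschemeι ⁻¹ᵁ (V : X₀.Opens))
              (unitSectionLE I.subschemeι (idealModule I.subschemeι) (le_refl (I.subschemeι ⁻¹ᵁ (V : X₀.Opens))) (s j)))) ∧
      𝒟'.ideal W = Ideal.span {∑ j, α j * j₀.appLE (V : X₀.Opens) (W : G₀.Opens) hWV (x j)} ⊔ (Ī.ideal W) ^ 2)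
    {G₁ : Scheme.{0}} [IsLocallyNoetherian G₁] (υ₁ : G₁ ⟶ G₀) (hυ₁ : IsBlowup υ₁ Ī)
    (E₁ : Set G₁) (hE₁ : IsClosed E₁) (Γ₁ : Set G₁) (hΓ₁ : IsClosed Γ₁)
    (hEĪ : vanishingIdeal (⟨E₁, hE₁⟩ : Closeds G₁) = Ī.comap υ₁)
    (hctr : controlledTransform υ₁ Ī 𝒟' 1 = vanishingIdeal (⟨Γ₁, hΓ₁⟩ : Closeds G₁))
    (i₁ : redSub G₁ Γ₁ hΓ₁ ⟶ redSub G₁ E₁ hE₁) (hi₁ : i₁ ≫ redSubι G₁ E₁ hE₁ = redSubι G₁ Γ₁ hΓ₁)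
    (Φ : Y' ≅ redSub G₁ Γ₁ hΓ₁) (hΦ : Φ.hom ≫ redSubι G₁ Γ₁ hΓ₁ ≫ υ₁ = ψ ≫ Ī.subschemeι) :
    HasRank (conormalSheaf i₁) 1 ∧
      ∀ (h𝒞 : IsFiniteLocallyFree (conormalSheaf i₁))
        (hF : IsFiniteLocallyFree ((Scheme.Modules.pullback g).obj ((Scheme.Modules.pullback ε).obj (conormalSheaf I.subschemeι))))
        (hL : IsFiniteLocallyFree (lineBundle (proportionalCocycle U hU w ρ hρ hprop))),
        CechPic.pullback Φ.hom (detClass h𝒞) * detClass hF = detClass hL ^ 2 := by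
  classical
  let F : Y'.Modules := (Scheme.Modules.pullback g).obj ((Scheme.Modules.pullback ε).obj (conormalSheaf I.subschemeι))
  let ψ' : Y' ⟶ G₀ := ψ ≫ Ī.subschemeι
  let ιE := redSubι G₁ E₁ hE₁
  let ιΓ := redSubι G₁ Γ₁ hΓ₁
  have hΦ' : Φ.hom ≫ ιΓ ≫ υ₁ = ψ' := hΦ
  have hz : ∀ p : Y', ψ' p ∈ Ī.support := fun p => by
    have h : ψ' p ∈ (Ī.support : Set G₀) := by
      rw [← Scheme.IdealSheafData.range_subschemeι]
      exact ⟨ψ p, rfl⟩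
    exact h
  choose V x s hreg hspan hs hUV W hWV hUW α hw h𝒟W using hDICT
  have hzW : ∀ p, ψ' p ∈ (W p : G₀.Opens) := fun p => hUW p (hU p)
  choose W' hzW' hW'W A c hAdet hA0 hcA hcspan hcqr hc𝒟 using
    fun p => exists_dictAdaptedFrame j₀ I Ī hĪ 𝒟' hdir' (V p) (x p) (hspan p) (W p) (hWV p) (α p) (h𝒟W p) (ψ' p) (hz p) (hzW p)
  have hc0 : ∀ p, c p 0 ∈ Ī.ideal (W' p) := fun p => mem_ideal_of_span_range_eq (W' p) (c p) (hcspan p) 0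
  have hc1 : ∀ p, c p 1 ∈ Ī.ideal (W' p) := fun p => mem_ideal_of_span_range_eq (W' p) (c p) (hcspan p) 1
  let Vc : Y' → G₁.Opens := fun p => blowupChart υ₁ Ī (W' p) (c p 1)
  choose T hT' using fun p => hυ₁.exists_chartRatio (W' p) (hc1 p) (hc0 p)
  have hT : ∀ p, υ₁.appLE (W' p) (Vc p) (blowupChart_le_preimage υ₁ Ī (W' p) (c p 1)) (c p 1) * T p =
      υ₁.appLE (W' p) (Vc p) (blowupChart_le_preimage υ₁ Ī (W' p) (c p 1)) (c p 0) := fun p => (hT' p).symm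
  let B : Y' → (redSub G₁ Γ₁ hΓ₁).Opens := fun p => i₁ ⁻¹ᵁ (ιE ⁻¹ᵁ (Vc p))
  choose sΓ κ hsΓ hκ using fun p => exists_conormalFrame_direction_chart hυ₁ 𝒟' E₁ hE₁ Γ₁ hΓ₁ hEĪ hctr i₁ hi₁ (W' p) (c p)
    (hcspan p) (hcqr p) (hc𝒟 p) (T p) (hT p) (B := B p) le_rfl
  have hιcomp : ∀ y : redSub G₁ Γ₁ hΓ₁, ιE (i₁ y) = ιΓ y := fun y => by
    change (i₁ ≫ ιE) y = ιΓ y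
    rw [show i₁ ≫ ιE = ιΓ from hi₁]
  have hυΦ : ∀ p : Y', υ₁ (ιΓ (Φ.hom p)) = ψ' p := fun p => by
    change (Φ.hom ≫ ιΓ ≫ υ₁) p = ψ' p
    rw [hΦ']
  have hmemB' : ∀ p : Y', Φ.hom p ∈ B p := by
    intro p
    change ιE (i₁ (Φ.hom p)) ∈ Vc p
    rw [hιcomp]
    refine mem_blowupChart_of_mem_support_controlledTransform_direction hυ₁ 𝒟' (W' p) (c p) (hcspan p) (hc𝒟 p) ?_ ?_
    · rw [hctr]
      have h : ιΓ (Φ.hom p) ∈ ((vanishingIdeal (⟨Γ₁, hΓ₁⟩ : Closeds G₁)).support : Set G₁) := by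
        rw [← Scheme.IdealSheafData.range_subschemeι]
        exact ⟨Φ.hom p, rfl⟩
      exact h
    · rw [hυΦ]
      exact hzW' p
  have hΦinv : ∀ x : redSub G₁ Γ₁ hΓ₁, Φ.hom (Φ.inv x) = x := fun x => by
    change (Φ.inv ≫ Φ.hom) x = x
    rw [Φ.inv_hom_id]
    rfl
  have hΦhom : ∀ p : Y', Φ.inv (Φ.hom p) = p := fun p => by
    change (Φ.hom ≫ Φ.inv) p = p
    rw [Φ.hom_inv_id]
    rfl
  have hmemB : ∀ x : redSub G₁ Γ₁ hΓ₁, x ∈ B (Φ.inv x) := fun x => by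
    have h := hmemB' (Φ.inv x)
    rwa [hΦinv] at h
  let F𝒞 : FrameSystem (conormalSheaf i₁) :=
    { U := fun x => B (Φ.inv x), mem := hmemB, I := fun _ => Fin 1, rank := fun _ => 1, enum := fun _ => Equiv.refl (Fin 1),
      frame := fun x => κ (Φ.inv x) }
  refine ⟨F𝒞.hasRank 1 fun _ => rfl, fun h𝒞 hF hL => ?_⟩
  rw [detClass_eq_mk h𝒞 F𝒞, CechPic.pullback_mk, detClass_eq_mk hL (proportionalCocycle U hU w ρ hρ hprop).lineBundleFrameSystem,
    UnitCocycle.mk_lineBundleFrameSystem_cocycle]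
  have hcNg : ∀ (p q : Y') (V' : Y'.Opens) (h1 : V' ≤ (UnitCocycle.pullback Φ.hom F𝒞.cocycle).U p)
      (h2 : V' ≤ (UnitCocycle.pullback Φ.hom F𝒞.cocycle).U q) (hp : V' ≤ Φ.hom ⁻¹ᵁ B p) (hq : V' ≤ Φ.hom ⁻¹ᵁ B q),
      (UnitCocycle.pullback Φ.hom F𝒞.cocycle).g p q V' h1 h2 =
        Φ.hom.appLE (B p ⊓ B q) V' (UnitCocycle.le_preimage_inf Φ.hom hp hq)
          (transition (κ p) (κ q) (homOfLE inf_le_left) (homOfLE inf_le_right) 0 0) := by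
    have aux : ∀ (p q p' q' : Y') (hpp : p' = p) (hqq : q' = q) (V' : Y'.Opens) (h1 : V' ≤ Φ.hom ⁻¹ᵁ B p') (h2 : V' ≤ Φ.hom ⁻¹ᵁ B q')
        (hp : V' ≤ Φ.hom ⁻¹ᵁ B p) (hq : V' ≤ Φ.hom ⁻¹ᵁ B q),
        Φ.hom.appLE (B p' ⊓ B q') V' (UnitCocycle.le_preimage_inf Φ.hom h1 h2)
            (transitionDet (κ p') (κ q') (Equiv.refl (Fin 1)) (Equiv.refl (Fin 1)) (homOfLE inf_le_left) (homOfLE inf_le_right)) =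
          Φ.hom.appLE (B p ⊓ B q) V' (UnitCocycle.le_preimage_inf Φ.hom hp hq)
            (transition (κ p) (κ q) (homOfLE inf_le_left) (homOfLE inf_le_right) 0 0) := by
      rintro p q _ _ rfl rfl V' h1 h2 hp hq
      rw [transitionDet_eq_of_subsingleton _ _ _ _ _ _ (0 : Fin 1) (0 : Fin 1)]
    intro p q V' h1 h2 hp hq
    exact aux p q (Φ.inv (Φ.hom p)) (Φ.inv (Φ.hom q)) (hΦhom p) (hΦhom q) V' h1 h2 hp hq
  have heV : ∀ p, ∃ e : SheafOfModules.free (Fin 2) ≅ (conormalSheaf I.subschemeι).over (I.subschemeι ⁻¹ᵁ (V p : X₀.Opens)),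
      ∀ j, basisSection e j = unitSectionLE I.subschemeι (idealModule I.subschemeι) (le_refl _) (s p j) := by
    intro p
    obtain ⟨s', e, hs', he⟩ := exists_conormalFrame_of_generators I.subschemeι (V p) (x p) (hreg p)
      (by rw [Scheme.IdealSheafData.ker_subschemeι]; exact hspan p)
    have hss : s' = s p := by
      funext j
      apply kernel_ι_app_injective (structureModuleMap I.subschemeι) (V p : X₀.Opens)
      change toRing (idealModuleι I.subschemeι) _ (s' j) = toRing (idealModuleι I.subschemeι) _ (s p j)
      rw [hs', hs]
    subst hss
    exact ⟨e, he⟩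
  choose eV heV using heV
  let U'' : Y' → Y'.Opens := fun p => U p ⊓ ψ' ⁻¹ᵁ (W' p : G₀.Opens) ⊓ Φ.hom ⁻¹ᵁ B p ⊓ (UnitCocycle.pullback Φ.hom F𝒞.cocycle).U p
  have hmem'' : ∀ p, p ∈ U'' p := fun p =>
    ⟨⟨⟨hU p, hzW' p⟩, hmemB' p⟩, (UnitCocycle.pullback Φ.hom F𝒞.cocycle).mem p⟩
  have hU''U : ∀ p, U'' p ≤ U p := fun p => ((inf_le_left.trans inf_le_left).trans inf_le_left)
  have hU''W : ∀ p, U'' p ≤ ψ' ⁻¹ᵁ (W' p : G₀.Opens) := fun p => ((inf_le_left.trans inf_le_left).trans inf_le_right)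
  have hU''B : ∀ p, U'' p ≤ Φ.hom ⁻¹ᵁ B p := fun p => inf_le_left.trans inf_le_right
  have hU''N : ∀ p, U'' p ≤ (UnitCocycle.pullback Φ.hom F𝒞.cocycle).U p := fun p => inf_le_right
  have hU''V : ∀ p, U'' p ≤ g ⁻¹ᵁ (ε ⁻¹ᵁ (I.subschemeι ⁻¹ᵁ (V p : X₀.Opens))) := fun p => (hU''U p).trans (hUV p)
  let fx : ∀ p, SheafOfModules.free (Fin 2) ≅ F.over (U'' p) := fun p =>
    SheafOfModules.restrictTrivialisation (R := Y'.ringCatSheaf) (homOfLE (hU''V p)) (pullbackFrame g (pullbackFrame ε (eV p)))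
  have hP : ∀ p, IsUnit ((A p).map (ψ'.appLE (W' p : G₀.Opens) (U'' p) (hU''W p)).hom).det := fun p => by
    rw [← RingHom.mapMatrix_apply, ← RingHom.map_det]
    exact (hAdet p).map _
  choose f hf using fun p => exists_frame_of_isUnit_det (fx p) ((A p).map (ψ'.appLE (W' p : G₀.Opens) (U'' p) (hU''W p)).hom) (hP p)
  have hf0 : ∀ p, basisSection (f p) 0 = F.presheaf.map (homOfLE (hU''U p)).op (w p) := by
    intro p
    rw [hf p 0, hw p, map_sum]
    refine Finset.sum_congr rfl fun j _ => ?_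
    rw [Scheme.Modules.map_smul, Matrix.map_apply, hA0 p j]
    congr 1
    · -- the coefficient `ψ'♯(α_j)` restricted to `U'' p`
      change (G₀.presheaf.map (homOfLE (hW'W p)).op ≫ ψ'.appLE (W' p : G₀.Opens) (U'' p) (hU''W p)) (α p j) =
        (ψ'.appLE (W p : G₀.Opens) (U p) (hUW p) ≫ Y'.presheaf.map (homOfLE (hU''U p)).op) (α p j)
      rw [Scheme.Hom.map_appLE, Scheme.Hom.appLE_map]
    · -- the section `η η η(s_j)` restricted to `U'' p`
      change basisSection (SheafOfModules.restrictTrivialisation (R := Y'.ringCatSheaf) (homOfLE (hU''V p))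
        (pullbackFrame g (pullbackFrame ε (eV p)))) j = _
      rw [basisSection_restrictTrivialisation, basisSection_pullbackFrame, basisSection_pullbackFrame, heV p j, presheaf_map_map]
      rfl
  have hfq0 : ∀ (p q : Y') (V' : Y'.Opens) (hp : V' ≤ U'' p) (hq : V' ≤ U'' q),
      F.presheaf.map (homOfLE hq).op (basisSection (f q) 0) =
        (proportionalCocycle U hU w ρ hρ hprop).g p q V' (hp.trans (hU''U p)) (hq.trans (hU''U q)) •
          F.presheaf.map (homOfLE hp).op (basisSection (f p) 0) := by
    intro p q V' hp hq
    rw [hf0, hf0, presheaf_map_map, presheaf_map_map,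
      Subsingleton.elim (homOfLE hq ≫ homOfLE (hU''U q)) (homOfLE (hq.trans (hU''U q))),
      Subsingleton.elim (homOfLE hp ≫ homOfLE (hU''U p)) (homOfLE (hp.trans (hU''U p)))]
    exact twisted_proportionalCocycle U hU w ρ hρ hprop p q V' (hp.trans (hU''U p)) (hq.trans (hU''U q))
  have h00 : ∀ (p q : Y') (V' : Y'.Opens) (hp : V' ≤ U'' p) (hq : V' ≤ U'' q),
      transition (f p) (f q) (homOfLE hp) (homOfLE hq) 0 0 =
        (proportionalCocycle U hU w ρ hρ hprop).g p q V' (hp.trans (hU''U p)) (hq.trans (hU''U q)) := by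
    intro p q V' hp hq
    rw [transition_apply, hfq0 p q V' hp hq, coord_smul, coord_map_basisSection, if_pos rfl, mul_one]
  have h10 : ∀ (p q : Y') (V' : Y'.Opens) (hp : V' ≤ U'' p) (hq : V' ≤ U'' q),
      transition (f p) (f q) (homOfLE hp) (homOfLE hq) 1 0 = 0 := by
    intro p q V' hp hq
    rw [transition_apply, hfq0 p q V' hp hq, coord_smul, coord_map_basisSection, if_neg (by decide), mul_zero]
  have hΦψ : Φ.hom ≫ i₁ ≫ ιE ≫ υ₁ = ψ' := by
    rw [← hΦ', ← Category.assoc i₁, show i₁ ≫ ιE = ιΓ from hi₁]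
  have hcompW : ∀ (W₂ : G₀.affineOpens) (O : G₁.affineOpens) (hOW : (O : G₁.Opens) ≤ υ₁ ⁻¹ᵁ (W₂ : G₀.Opens))
      (B₂ : (redSub G₁ Γ₁ hΓ₁).Opens) (hB₂ : B₂ ≤ i₁ ⁻¹ᵁ (ιE ⁻¹ᵁ (O : G₁.Opens))) (V'' : Y'.Opens) (hV'' : V'' ≤ Φ.hom ⁻¹ᵁ B₂)
      (hψV : V'' ≤ ψ' ⁻¹ᵁ (W₂ : G₀.Opens)) (a : Γ(G₀, (W₂ : G₀.Opens))),
      Φ.hom.appLE B₂ V'' hV'' (i₁.appLE (ιE ⁻¹ᵁ (O : G₁.Opens)) B₂ hB₂ (ιE.app O (υ₁.appLE W₂ O hOW a))) =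
        ψ'.appLE W₂ V'' hψV a := by
    intro W₂ O hOW B₂ hB₂ V'' hV'' hψV a
    have key : ∀ (f₁ f₂ : Y' ⟶ G₀) (h : f₁ = f₂) (e₁ : V'' ≤ f₁ ⁻¹ᵁ (W₂ : G₀.Opens)) (e₂ : V'' ≤ f₂ ⁻¹ᵁ (W₂ : G₀.Opens)),
        f₁.appLE W₂ V'' e₁ a = f₂.appLE W₂ V'' e₂ a := by
      rintro f₁ _ rfl _ _; rfl
    have e3 : V'' ≤ (Φ.hom ≫ i₁ ≫ ιE ≫ υ₁) ⁻¹ᵁ (W₂ : G₀.Opens) := by rw [hΦψ]; exact hψV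
    rw [← key (Φ.hom ≫ i₁ ≫ ιE ≫ υ₁) ψ' hΦψ e3 hψV]
    have s1 : ιE.app O (υ₁.appLE W₂ O hOW a) = (ιE ≫ υ₁).appLE W₂ (ιE ⁻¹ᵁ (O : G₁.Opens)) (ιE.preimage_mono hOW) a := by
      rw [Scheme.Hom.app_eq_appLE, ← CommRingCat.comp_apply, Scheme.Hom.appLE_comp_appLE]
    have s2 : i₁.appLE (ιE ⁻¹ᵁ (O : G₁.Opens)) B₂ hB₂ ((ιE ≫ υ₁).appLE W₂ (ιE ⁻¹ᵁ (O : G₁.Opens)) (ιE.preimage_mono hOW) a) =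
        (i₁ ≫ ιE ≫ υ₁).appLE W₂ B₂ (hB₂.trans (i₁.preimage_mono (ιE.preimage_mono hOW))) a := by
      rw [← CommRingCat.comp_apply, Scheme.Hom.appLE_comp_appLE]
    have s3 : Φ.hom.appLE B₂ V'' hV'' ((i₁ ≫ ιE ≫ υ₁).appLE W₂ B₂ (hB₂.trans (i₁.preimage_mono (ιE.preimage_mono hOW))) a) =
        (Φ.hom ≫ i₁ ≫ ιE ≫ υ₁).appLE W₂ V'' e3 a := by
      rw [← CommRingCat.comp_apply, Scheme.Hom.appLE_comp_appLE]
    rw [s1, s2, s3]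
  have hloc : ∀ (p q : Y') (V' : Y'.Opens) (hp : V' ≤ U'' p) (hq : V' ≤ U'' q) (v : Y'), v ∈ V' →
      ∃ (V'' : Y'.Opens) (hV'' : V'' ≤ V'), v ∈ V'' ∧
        (UnitCocycle.pullback Φ.hom F𝒞.cocycle).g p q V'' ((hV''.trans hp).trans (hU''N p)) ((hV''.trans hq).trans (hU''N q)) *
            transition (f p) (f q) (homOfLE (hV''.trans hp)) (homOfLE (hV''.trans hq)) 1 1 =
          transition (f p) (f q) (homOfLE (hV''.trans hp)) (homOfLE (hV''.trans hq)) 0 0 := by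
    intro p q V' hp hq v hv
    have hjψ : ∀ v : Y', j₀ (ψ' v) = I.subschemeι (ε (g v)) := fun v => by
      change (ψ ≫ Ī.subschemeι ≫ j₀) v = (g ≫ ε ≫ I.subschemeι) v
      rw [hψ]
    have hvVp : j₀ (ψ' v) ∈ (V p : X₀.Opens) := by rw [hjψ]; exact hU''V p (hp hv)
    have hvVq : j₀ (ψ' v) ∈ (V q : X₀.Opens) := by rw [hjψ]; exact hU''V q (hq hv)
    obtain ⟨V₂', hV₂aff, hvV₂, hV₂sub⟩ := exists_isAffineOpen_mem_and_subset (X := X₀) (x := j₀ (ψ' v))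
      (U := (V p : X₀.Opens) ⊓ V q) ⟨hvVp, hvVq⟩
    let V₂ : X₀.affineOpens := ⟨V₂', hV₂aff⟩
    have hV₂p : (V₂ : X₀.Opens) ≤ V p := fun y hy => (hV₂sub hy).1
    have hV₂q : (V₂ : X₀.Opens) ≤ V q := fun y hy => (hV₂sub hy).2
    obtain ⟨N', hN'⟩ := exists_changeOfGenerators I hV₂p hV₂q (x p) (x q) (hspan p) (hspan q)
    let N : Matrix (Fin 2) (Fin 2) Γ(X₀, (V₂ : X₀.Opens)) := Matrix.of N'
    have hN : ∀ j, X₀.presheaf.map (homOfLE hV₂q).op (x q j) = ∑ l, N j l * X₀.presheaf.map (homOfLE hV₂p).op (x p l) := hN'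
    obtain ⟨W₂', hW₂aff, hvW₂, hW₂sub⟩ := exists_isAffineOpen_mem_and_subset (X := G₀) (x := ψ' v)
      (U := (W' p : G₀.Opens) ⊓ W' q ⊓ j₀ ⁻¹ᵁ (V₂ : X₀.Opens)) ⟨⟨hU''W p (hp hv), hU''W q (hq hv)⟩, hvV₂⟩
    let W₂ : G₀.affineOpens := ⟨W₂', hW₂aff⟩
    have hW₂p : (W₂ : G₀.Opens) ≤ W' p := fun y hy => (hW₂sub hy).1.1
    have hW₂q : (W₂ : G₀.Opens) ≤ W' q := fun y hy => (hW₂sub hy).1.2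
    have hW₂V : (W₂ : G₀.Opens) ≤ j₀ ⁻¹ᵁ (V₂ : X₀.Opens) := fun y hy => (hW₂sub hy).2
    have hW'Vp : (W' p : G₀.Opens) ≤ j₀ ⁻¹ᵁ (V p : X₀.Opens) := (hW'W p).trans (hWV p)
    have hW'Vq : (W' q : G₀.Opens) ≤ j₀ ⁻¹ᵁ (V q : X₀.Opens) := (hW'W q).trans (hWV q)
    let M' : Matrix (Fin 2) (Fin 2) Γ(G₀, (W₂ : G₀.Opens)) :=
      (A q).map (G₀.presheaf.map (homOfLE hW₂q).op).hom * N.map (j₀.appLE (V₂ : X₀.Opens) (W₂ : G₀.Opens) hW₂V).hom *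
        ((A p).map (G₀.presheaf.map (homOfLE hW₂p).op).hom)⁻¹
    have hcA' : ∀ p i, c p i = ∑ j, A p i j * j₀.appLE (V p : X₀.Opens) (W' p : G₀.Opens) ((hW'W p).trans (hWV p)) (x p j) := by
      intro p i
      rw [hcA p i]
      refine Finset.sum_congr rfl fun j _ => ?_
      congr 1
      rw [← CommRingCat.comp_apply, Scheme.Hom.appLE_map]
    have hrelM : ∀ i, G₀.presheaf.map (homOfLE hW₂q).op (c q i) = ∑ r, M' i r * G₀.presheaf.map (homOfLE hW₂p).op (c p r) :=
      fun i => adaptedFrame_rel_of_dict j₀ (V p) (V q) V₂ hV₂p hV₂q (x p) (x q) N hN (W' p) (W' q) W₂ hW'Vp hW'Vq hW₂p hW₂q hW₂V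
        (A p) (A q) (hAdet p) (c p) (c q) (hcA' p) (hcA' q) i
    have hrel₀ : G₀.presheaf.map (homOfLE hW₂q).op (c q 0) =
        M' 0 0 * G₀.presheaf.map (homOfLE hW₂p).op (c p 0) + M' 0 1 * G₀.presheaf.map (homOfLE hW₂p).op (c p 1) := by
      rw [hrelM 0, Fin.sum_univ_two]
    have hrel₁ : G₀.presheaf.map (homOfLE hW₂q).op (c q 1) =
        M' 1 0 * G₀.presheaf.map (homOfLE hW₂p).op (c p 0) + M' 1 1 * G₀.presheaf.map (homOfLE hW₂p).op (c p 1) := by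
      rw [hrelM 1, Fin.sum_univ_two]
    have hb₀ : M' 0 1 ∈ Ī.ideal W₂ := mem_ideal_of_adaptedFrame_rel Ī 𝒟' hdir' (W' p) (W' q) W₂ (c p) (c q) (hcspan p)
      (hc𝒟 p) (hc𝒟 q) hW₂p hW₂q (M' 0 0) (M' 0 1) hrel₀
    have hΦvp : ιΓ (Φ.hom v) ∈ Vc p := by rw [← hιcomp]; exact hU''B p (hp hv)
    have hΦvq : ιΓ (Φ.hom v) ∈ Vc q := by rw [← hιcomp]; exact hU''B q (hq hv)
    have hΦvW : υ₁ (ιΓ (Φ.hom v)) ∈ (W₂ : G₀.Opens) := by rw [hυΦ]; exact hvW₂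
    obtain ⟨O', hOaff, hvO, hOsub⟩ := exists_isAffineOpen_mem_and_subset (X := G₁) (x := ιΓ (Φ.hom v))
      (U := Vc p ⊓ Vc q ⊓ υ₁ ⁻¹ᵁ (W₂ : G₀.Opens)) ⟨⟨hΦvp, hΦvq⟩, hΦvW⟩
    let O : G₁.affineOpens := ⟨O', hOaff⟩
    have hOp : (O : G₁.Opens) ≤ Vc p := fun y hy => (hOsub hy).1.1
    have hOq : (O : G₁.Opens) ≤ Vc q := fun y hy => (hOsub hy).1.2
    have hOW : (O : G₁.Opens) ≤ υ₁ ⁻¹ᵁ (W₂ : G₀.Opens) := fun y hy => (hOsub hy).2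
    obtain ⟨β, hG₁⟩ := chartRatio_rel_of_adapted_frames hυ₁ (W' p) (W' q) W₂ (c p) (c q) (hc1 p) hW₂p hW₂q
      (M' 0 0) (M' 0 1) (M' 1 0) (M' 1 1) hb₀ hrel₀ hrel₁ (T p) (hT p) (T q) (hT q) O hOp hOq hOW
    have hEx := chartRatio_rel_on_exceptional E₁ hE₁ hEĪ (W' p) W₂ (c p) (hc1 p) hW₂p (M' 0 0) (M' 1 0) (M' 1 1) O hOW
      (G₁.presheaf.map (homOfLE hOp).op (T p)) (G₁.presheaf.map (homOfLE hOq).op (T q)) β hG₁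
    have hOx' : ιE ⁻¹ᵁ (O : G₁.Opens) ≤ ιE ⁻¹ᵁ Vc p := ιE.preimage_mono hOp
    have hOy' : ιE ⁻¹ᵁ (O : G₁.Opens) ≤ ιE ⁻¹ᵁ Vc q := ιE.preimage_mono hOq
    have hTres : ∀ (p : Y') (hO : (O : G₁.Opens) ≤ Vc p),
        ιE.app O (G₁.presheaf.map (homOfLE hO).op (T p)) =
          (redSub G₁ E₁ hE₁).presheaf.map (homOfLE (ιE.preimage_mono hO)).op (ιE.appLE (Vc p) (ιE ⁻¹ᵁ Vc p) le_rfl (T p)) := by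
      intro p hO
      rw [Scheme.Hom.app_eq_appLE, ← CommRingCat.comp_apply, Scheme.Hom.map_appLE, ← CommRingCat.comp_apply, Scheme.Hom.appLE_map]
    rw [hTres p hOp, hTres q hOq] at hEx
    let B₂ : (redSub G₁ Γ₁ hΓ₁).Opens := B p ⊓ B q ⊓ i₁ ⁻¹ᵁ (ιE ⁻¹ᵁ (O : G₁.Opens))
    have hBBx : B₂ ≤ B p := inf_le_left.trans inf_le_left
    have hBBy : B₂ ≤ B q := inf_le_left.trans inf_le_right
    have hB₂ : B₂ ≤ i₁ ⁻¹ᵁ (ιE ⁻¹ᵁ (O : G₁.Opens)) := inf_le_right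
    have hTx0 : i₁.appLE (ιE ⁻¹ᵁ (O : G₁.Opens)) B₂ hB₂
        ((redSub G₁ E₁ hE₁).presheaf.map (homOfLE hOx').op (ιE.appLE (Vc p) (ιE ⁻¹ᵁ Vc p) le_rfl (T p))) = 0 := by
      have hB₂Γ : B₂ ≤ ιΓ ⁻¹ᵁ Vc p := fun y hy => by
        change ιΓ y ∈ Vc p
        rw [← hιcomp]
        exact hBBx hy
      rw [← CommRingCat.comp_apply, Scheme.Hom.map_appLE, ← CommRingCat.comp_apply, Scheme.Hom.appLE_comp_appLE,
        appLE_congr_hom (show i₁ ≫ ιE = ιΓ from hi₁) (Vc p) B₂ _ hB₂Γ]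
      change (redSub G₁ Γ₁ hΓ₁).presheaf.map _ ((ιΓ.app (Vc p)).hom (T p)) = 0
      have hker : T p ∈ RingHom.ker (ιΓ.app (Vc p)).hom := by
        have h := ker_subschemeι_app (vanishingIdeal (⟨Γ₁, hΓ₁⟩ : Closeds G₁)) ⟨Vc p, hυ₁.isAffineOpen_blowupChart (hc1 p)⟩
        change RingHom.ker (ιΓ.app (Vc p)).hom = _ at h
        rw [h, ← hctr, ideal_controlledTransform_direction_chart hυ₁ 𝒟' (W' p) (c p) (hc1 p) (hc𝒟 p) (T p) (hT p)]
        exact Ideal.mem_sup_left (Ideal.mem_span_singleton_self _)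
      rw [RingHom.mem_ker] at hker
      rw [hker, map_zero]
    have hNc := transition_conormalFrame_mul i₁ (ιE ⁻¹ᵁ (O : G₁.Opens)) (ιE ⁻¹ᵁ Vc p) (ιE ⁻¹ᵁ Vc q) hOx' hOy'
      (ιE.app O (υ₁.appLE W₂ O hOW (M' 1 0))) (ιE.app O (υ₁.appLE W₂ O hOW (M' 1 1))) (ιE.app O (υ₁.appLE W₂ O hOW (M' 0 0)))
      (ιE.appLE (Vc p) (ιE ⁻¹ᵁ Vc p) le_rfl (T p)) (ιE.appLE (Vc q) (ιE ⁻¹ᵁ Vc q) le_rfl (T q)) hEx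
      (sΓ p) (sΓ q) (hsΓ p) (hsΓ q) (Bx := B p) (By := B q) (B := B₂) le_rfl le_rfl hBBx hBBy hB₂ hTx0 (κ p) (κ q) (hκ p) (hκ q)
    let V'' : Y'.Opens := V' ⊓ Φ.hom ⁻¹ᵁ B₂ ⊓ ψ' ⁻¹ᵁ (W₂ : G₀.Opens)
    have hV'' : V'' ≤ V' := inf_le_left.trans inf_le_left
    have hV''B : V'' ≤ Φ.hom ⁻¹ᵁ B₂ := inf_le_left.trans inf_le_right
    have hV''W : V'' ≤ ψ' ⁻¹ᵁ (W₂ : G₀.Opens) := inf_le_right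
    have hvV'' : v ∈ V'' := by
      refine ⟨⟨hv, ?_⟩, hvW₂⟩
      change Φ.hom v ∈ B₂
      refine ⟨⟨hU''B p (hp hv), hU''B q (hq hv)⟩, ?_⟩
      change ιE (i₁ (Φ.hom v)) ∈ (O : G₁.Opens)
      rw [hιcomp]
      exact hvO
    refine ⟨V'', hV'', hvV'', ?_⟩
    have hN' : transition (κ p) (κ q) (homOfLE hBBx) (homOfLE hBBy) 0 0 *
        i₁.appLE (ιE ⁻¹ᵁ (O : G₁.Opens)) B₂ hB₂ (ιE.app O (υ₁.appLE W₂ O hOW (M' 1 1))) =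
          i₁.appLE (ιE ⁻¹ᵁ (O : G₁.Opens)) B₂ hB₂ (ιE.app O (υ₁.appLE W₂ O hOW (M' 0 0))) := hNc
    have hdag : (UnitCocycle.pullback Φ.hom F𝒞.cocycle).g p q V'' ((hV''.trans hp).trans (hU''N p)) ((hV''.trans hq).trans (hU''N q)) *
        ψ'.appLE W₂ V'' hV''W (M' 1 1) = ψ'.appLE W₂ V'' hV''W (M' 0 0) := by
      have h := congrArg (Φ.hom.appLE B₂ V'' hV''B) hN'
      rw [map_mul, hcompW W₂ O hOW B₂ hB₂ V'' hV''B hV''W, hcompW W₂ O hOW B₂ hB₂ V'' hV''B hV''W] at h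
      have ht := congrFun (congrFun (transition_map (κ p) (κ q) (homOfLE (inf_le_left : B p ⊓ B q ≤ B p))
        (homOfLE (inf_le_right : B p ⊓ B q ≤ B q)) (homOfLE (inf_le_left : B₂ ≤ B p ⊓ B q))) 0) 0
      rw [Matrix.map_apply, Subsingleton.elim (homOfLE (inf_le_left : B₂ ≤ B p ⊓ B q) ≫ homOfLE inf_le_left) (homOfLE hBBx),
        Subsingleton.elim (homOfLE (inf_le_left : B₂ ≤ B p ⊓ B q) ≫ homOfLE inf_le_right) (homOfLE hBBy)] at ht
      have hg : (UnitCocycle.pullback Φ.hom F𝒞.cocycle).g p q V'' ((hV''.trans hp).trans (hU''N p)) ((hV''.trans hq).trans (hU''N q)) =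
          Φ.hom.appLE B₂ V'' hV''B (transition (κ p) (κ q) (homOfLE hBBx) (homOfLE hBBy) 0 0) := by
        rw [hcNg p q V'' _ _ ((hV''.trans hp).trans (hU''B p)) ((hV''.trans hq).trans (hU''B q)), ← ht, ← CommRingCat.comp_apply,
          Scheme.Hom.map_appLE]
      rw [hg]
      exact h
    have hS2 : ∀ r i, transition (f p) (f q) (homOfLE (hV''.trans hp)) (homOfLE (hV''.trans hq)) r i = ψ'.appLE W₂ V'' hV''W (M' i r) := by
      intro r i
      refine transition_dictFrame_eq j₀ I ε g Ī ψ hψ (V p) (V q) V₂ hV₂p hV₂q (x p) (x q) (s p) (s q) (hs p) (hs q) (eV p) (eV q)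
        (heV p) (heV q) N hN (W' p) (W' q) W₂ hW₂p hW₂q hW₂V (A p) (A q) (hAdet p) (U'' p) (U'' q) (hU''V p) (hU''V q) (hU''W p) (hU''W q)
        (f p) (f q) ?_ ?_ V'' (hV''.trans hp) (hV''.trans hq) hV''W r i
      · intro i; rw [hf p i]
        refine Finset.sum_congr rfl fun j _ => ?_
        rw [Matrix.map_apply, basisSection_restrictTrivialisation]
      · intro i; rw [hf q i]
        refine Finset.sum_congr rfl fun j _ => ?_
        rw [Matrix.map_apply, basisSection_restrictTrivialisation]
    rw [hS2, hS2]
    exact hdag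
  exact cechPic_mk_mul_detClass_eq_sq hF U'' hmem'' f (proportionalCocycle U hU w ρ hρ hprop) (UnitCocycle.pullback Φ.hom F𝒞.cocycle)
    hU''U hU''N h00 h10 hloc

end Summit.ResolutionOfSingularities.ResolutionOfSingularities.Cruxes.EquisingularLiftNat.Sections

end
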